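import Mathlib
import HarnessLib
import Summits.NavierStokesRegularity.NavierStokesRegularity.Theorems.PoloidalWindowDoorPoloidalWindowRigidityWeightTrace

/-!
# Route `PoloidalWindowDoor`, crux `PoloidalWindowRigidity` (stmt-19708), LINE 9 `sonic_cut` of ns-idea-8: STUB B1 `stub_balanceDatum` — the BALANCE
# DATUM of the three null Lagrangians against arbitrary `C²` weights, at every centre, with the typed rate `K' R^{−1/2} (−s)^{−1/4}`

Seat ns-poloidal-K2-p2 g10 (LEAD-lineage on 19708; file `--supports`).  For a profile of the route's Type-I class, poloidal along `e₃`, a slice `s < 0`,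
a centre `c`, a scale `R > 0` and a weight `χ ∈ C²` with `χ = 0` where `‖y − c‖ ≥ 2R` and `‖iteratedFDeriv ℝ 2 χ‖ ≤ R⁻²`, the weighted masses of
`Q₃ = ∂₂v₀∂₀v₂ + ∂₂v₁∂₁v₂ + (∂₂v₂)²`, of `det ∇ₕvₕ` and of `e = Σᵢⱼ ∂ⱼvᵢ∂ᵢvⱼ` are all `≤ (5/2)·R⁻² ∫_{B̄(c,2R)} |v(s)|²` — by the landed null-Lagrangian
identities `…RieszCollapse.integral_mul_traceSq_eq_integral_hessian` (trace; weight form `…WeightTrace.abs_integral_weight_mul_traceSq_le`, p655342) and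
`…HorizontalDet.integral_mul_jacobian_eq` (Jacobian, p652990; here `abs_integral_weight_mul_jacobian_le`), and `Q₃ = det + ½e`
(`…PairingCollapse.pairing_eq_det_add_half_trace`).  The energy in `B̄(c,2R)` is `≤ 3KR` by S1 (`…ScaledEnergy.scaledEnergy`, every centre) AND
`≤ 8V C² R³/(−s)` by the Type-I rate (`V = |B̄(0,1)|`); the interpolation `min(a,b) ≤ a^{3/4} b^{1/4}` (`interpolate_threeQuarter`) turns `R⁻²·min`
into B1's typed rate `K'·R^{−1/2}(−s)^{−1/4}` — no translation of the uniform energy LEVEL is needed.  Statement VERBATIM from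
`Cruxes/PoloidalWindowRigidity/Lines/sonic_cut.lean` (l. 163–178; price P9-3/P9-1 of idea-crit-7 g3).

WHAT THIS IS NOT: not a claim about Navier–Stokes regularity; the entry datum for T3 of LINE 9 (bears_on LADDER-NS N0 via crux 19708). [folklore]
-/

noncomputable section

-- the summit and its single sub-problem share the name (CONVENTIONS §1), as in every Theorems file
set_option linter.dupNamespace false

namespace Summit.NavierStokesRegularity.NavierStokesRegularity.Theorems.PoloidalWindowDoorPoloidalWindowRigidityBalanceDatum

open MeasureTheory Set Function Filter Topology Metric InnerProductSpace
open scoped RealInnerProductSpace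
open Literature.Analysis Literature.Analysis.FluidPDE
open Summit.NavierStokesRegularity.NavierStokesRegularity.Theorems.PoloidalWindowDoorPoloidalWindowRigidityWindow
open Summit.NavierStokesRegularity.NavierStokesRegularity.Theorems.PoloidalWindowDoorPoloidalWindowRigidityEquipartition
open Summit.NavierStokesRegularity.NavierStokesRegularity.Theorems.PoloidalWindowDoorPoloidalWindowRigidityStrainGrowth
open Summit.NavierStokesRegularity.NavierStokesRegularity.Theorems.PoloidalWindowDoorPoloidalWindowRigiditySparseEnergyScaledEnergy
open Summit.NavierStokesRegularity.NavierStokesRegularity.Theorems.PoloidalWindowDoorPoloidalWindowRigidityRieszCollapse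
open Summit.NavierStokesRegularity.NavierStokesRegularity.Theorems.PoloidalWindowDoorPoloidalWindowRigidityHorizontalDet
open Summit.NavierStokesRegularity.NavierStokesRegularity.Theorems.PoloidalWindowDoorPoloidalWindowRigidityPairingCollapse
open Summit.NavierStokesRegularity.NavierStokesRegularity.Theorems.PoloidalWindowDoorPoloidalWindowRigidityWeightTrace

/-! ### The Jacobian mass against a general weight -/

/-- **`|∫ χ (∂_p a ∂_q b − ∂_q a ∂_p b)| ≤ 2R⁻² ∫_{B̄(c,2R)} |u|²`** for the coordinates `a = u₀`, `b = u₁` of a `C²` field with `∂₀u₁ = ∂₁u₀`, the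
directions `p = e₀`, `q = e₁`, and a `C²` weight `χ` vanishing where `‖y − c‖ ≥ 2R` with `‖iteratedFDeriv ℝ 2 χ‖ ≤ R⁻²`. [folklore] -/
theorem abs_integral_weight_mul_jacobian_le {u : EuclideanSpace ℝ (Fin 3) → EuclideanSpace ℝ (Fin 3)} (hu : ContDiff ℝ 2 u)
    (hω : ∀ x, fderiv ℝ u x (EuclideanSpace.single 0 1) 1 = fderiv ℝ u x (EuclideanSpace.single 1 1) 0)
    {χ : EuclideanSpace ℝ (Fin 3) → ℝ} (hχ : ContDiff ℝ 2 χ) {c : EuclideanSpace ℝ (Fin 3)} {R : ℝ}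
    (hsupp : ∀ y, 2 * R ≤ ‖y - c‖ → χ y = 0) (hD2 : ∀ y, ‖iteratedFDeriv ℝ 2 χ y‖ ≤ 1 / R ^ 2) :
    |∫ x, χ x * (fderiv ℝ u x (EuclideanSpace.single 0 1) 0 * fderiv ℝ u x (EuclideanSpace.single 1 1) 1 -
        fderiv ℝ u x (EuclideanSpace.single 1 1) 0 * fderiv ℝ u x (EuclideanSpace.single 0 1) 1)| ≤
      2 / R ^ 2 * ∫ x in closedBall c (2 * R), ‖u x‖ ^ 2 := by
  have hχc : HasCompactSupport χ := by
    refine HasCompactSupport.intro (isCompact_closedBall c (2 * R)) fun y hy => hsupp y ?_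
    rw [mem_closedBall, dist_eq_norm, not_le] at hy
    exact hy.le
  obtain ⟨ha, hDa⟩ := coord_contDiff_fderiv hu 0
  obtain ⟨hb, hDb⟩ := coord_contDiff_fderiv hu 1
  have hsym : ∀ x, fderiv ℝ (fun y => u y 1) x (EuclideanSpace.single 0 1) = fderiv ℝ (fun y => u y 0) x (EuclideanSpace.single 1 1) := by
    intro x; rw [hDa, hDb]; exact hω x
  -- rewrite the integrand in coordinates and apply the Jacobian identity
  have hcoord : (fun x => χ x * (fderiv ℝ u x (EuclideanSpace.single 0 1) 0 * fderiv ℝ u x (EuclideanSpace.single 1 1) 1 -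
      fderiv ℝ u x (EuclideanSpace.single 1 1) 0 * fderiv ℝ u x (EuclideanSpace.single 0 1) 1)) =
      fun x => χ x * (fderiv ℝ (fun y => u y 0) x (EuclideanSpace.single 0 1) * fderiv ℝ (fun y => u y 1) x (EuclideanSpace.single 1 1) -
        fderiv ℝ (fun y => u y 0) x (EuclideanSpace.single 1 1) * fderiv ℝ (fun y => u y 1) x (EuclideanSpace.single 0 1)) := by
    funext x; rw [hDa, hDa, hDb, hDb, hω x]
  rw [hcoord, integral_mul_jacobian_eq ha hb hχ hχc hsym]
  -- the second derivatives of `χ`: bounded by `R⁻²`, zero off `B̄(c,2R)`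
  set B : Set (EuclideanSpace ℝ (Fin 3)) := closedBall c (2 * R) with hB
  have hU : IsOpen {y : EuclideanSpace ℝ (Fin 3) | 2 * R < ‖y - c‖} :=
    isOpen_lt continuous_const (continuous_id.sub continuous_const).norm
  have hDχU : ∀ p : EuclideanSpace ℝ (Fin 3), ∀ y ∈ {y : EuclideanSpace ℝ (Fin 3) | 2 * R < ‖y - c‖}, fderiv ℝ χ y p = 0 := by
    intro p y hy
    have hev : χ =ᶠ[𝓝 y] fun _ => 0 := by
      filter_upwards [hU.mem_nhds hy] with y' hy'
      exact hsupp y' (le_of_lt hy')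
    rw [hev.fderiv_eq]
    simp
  have hzero2 : ∀ p q : EuclideanSpace ℝ (Fin 3), ∀ x ∉ B, fderiv ℝ (fun y => fderiv ℝ χ y p) x q = 0 := by
    intro p q x hx
    have hxU : x ∈ {y : EuclideanSpace ℝ (Fin 3) | 2 * R < ‖y - c‖} := by
      rw [hB, mem_closedBall, dist_eq_norm, not_le] at hx; exact hx
    have hev : (fun y => fderiv ℝ χ y p) =ᶠ[𝓝 x] fun _ => 0 := by
      filter_upwards [hU.mem_nhds hxU] with y hy
      exact hDχU p y hy
    rw [hev.fderiv_eq]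
    simp
  have he0 : ‖(EuclideanSpace.single 0 (1 : ℝ) : EuclideanSpace ℝ (Fin 3))‖ ≤ 1 := by simp
  have he1 : ‖(EuclideanSpace.single 1 (1 : ℝ) : EuclideanSpace ℝ (Fin 3))‖ ≤ 1 := by simp
  have huc : Continuous u := hu.continuous
  have hintB : IntegrableOn (fun x => ‖u x‖ ^ 2) B := (huc.norm.pow 2).continuousOn.integrableOn_compact (isCompact_closedBall _ _)
  -- generic bound: `|∫ g ∂_q∂_p χ| ≤ R⁻² ∫_B |u|²` whenever `|g| ≤ |u|²`, `g` continuous, `‖p‖, ‖q‖ ≤ 1`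
  have hgen : ∀ (g : EuclideanSpace ℝ (Fin 3) → ℝ) (p q : EuclideanSpace ℝ (Fin 3)), Continuous g → (∀ x, |g x| ≤ ‖u x‖ ^ 2) →
      ‖p‖ ≤ 1 → ‖q‖ ≤ 1 →
      |∫ x, g x * fderiv ℝ (fun y => fderiv ℝ χ y p) x q| ≤ 1 / R ^ 2 * ∫ x in B, ‖u x‖ ^ 2 := by
    intro g p q hg hgu hp hq
    have hz : ∀ x ∉ B, g x * fderiv ℝ (fun y => fderiv ℝ χ y p) x q = 0 := fun x hx => by rw [hzero2 p q x hx, mul_zero]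
    rw [← setIntegral_eq_integral_of_forall_compl_eq_zero hz]
    have hcont2 : Continuous fun x => fderiv ℝ (fun y => fderiv ℝ χ y p) x q :=
      ((((hχ.fderiv_right (m := 1) le_rfl).clm_apply contDiff_const).continuous_fderiv one_ne_zero).clm_apply continuous_const)
    have hIi : IntegrableOn (fun x => g x * fderiv ℝ (fun y => fderiv ℝ χ y p) x q) B :=
      (hg.mul hcont2).continuousOn.integrableOn_compact (isCompact_closedBall _ _)
    have hpt : ∀ x ∈ B, ‖g x * fderiv ℝ (fun y => fderiv ℝ χ y p) x q‖ ≤ 1 / R ^ 2 * ‖u x‖ ^ 2 := by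
      intro x _
      rw [norm_mul, Real.norm_eq_abs, Real.norm_eq_abs]
      have h2 : |fderiv ℝ (fun y => fderiv ℝ χ y p) x q| ≤ 1 / R ^ 2 := by
        refine (abs_fderiv_fderiv_apply_le hχ x p q).trans ?_
        have h3 : ‖iteratedFDeriv ℝ 2 χ x‖ * ‖q‖ * ‖p‖ ≤ 1 / R ^ 2 * 1 * 1 :=
          mul_le_mul (mul_le_mul (hD2 x) hq (norm_nonneg _) (by positivity)) hp (norm_nonneg _) (by positivity)
        linarith
      calc |g x| * |fderiv ℝ (fun y => fderiv ℝ χ y p) x q| ≤ ‖u x‖ ^ 2 * (1 / R ^ 2) :=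
            mul_le_mul (hgu x) h2 (abs_nonneg _) (sq_nonneg _)
        _ = 1 / R ^ 2 * ‖u x‖ ^ 2 := by ring
    calc |∫ x in B, g x * fderiv ℝ (fun y => fderiv ℝ χ y p) x q|
        ≤ ∫ x in B, 1 / R ^ 2 * ‖u x‖ ^ 2 := by
          rw [← Real.norm_eq_abs]
          exact (norm_integral_le_integral_norm _).trans (setIntegral_mono_on hIi.norm (hintB.const_mul _) measurableSet_closedBall hpt)
      _ = 1 / R ^ 2 * ∫ x in B, ‖u x‖ ^ 2 := integral_const_mul _ _
  have hn0 : ∀ x, |u x 0| ≤ ‖u x‖ := fun x => by rw [← Real.norm_eq_abs]; exact PiLp.norm_apply_le (u x) 0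
  have hn1 : ∀ x, |u x 1| ≤ ‖u x‖ := fun x => by rw [← Real.norm_eq_abs]; exact PiLp.norm_apply_le (u x) 1
  have g1 := hgen (fun x => u x 0 * u x 1) (EuclideanSpace.single 0 1) (EuclideanSpace.single 1 1) (ha.continuous.mul hb.continuous)
    (fun x => by rw [abs_mul, sq]; exact mul_le_mul (hn0 x) (hn1 x) (abs_nonneg _) (norm_nonneg _)) he0 he1
  have g2 := hgen (fun x => u x 1 ^ 2) (EuclideanSpace.single 0 1) (EuclideanSpace.single 0 1) (hb.continuous.pow 2)
    (fun x => by rw [abs_of_nonneg (sq_nonneg _), ← sq_abs]; exact pow_le_pow_left₀ (abs_nonneg _) (hn1 x) 2) he0 he0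
  have g3 := hgen (fun x => u x 0 ^ 2) (EuclideanSpace.single 1 1) (EuclideanSpace.single 1 1) (ha.continuous.pow 2)
    (fun x => by rw [abs_of_nonneg (sq_nonneg _), ← sq_abs]; exact pow_le_pow_left₀ (abs_nonneg _) (hn0 x) 2) he1 he1
  have h1 := abs_le.1 g1
  have h2 := abs_le.1 g2
  have h3 := abs_le.1 g3
  have hE : 2 / R ^ 2 * ∫ x in B, ‖u x‖ ^ 2 = 2 * (1 / R ^ 2 * ∫ x in B, ‖u x‖ ^ 2) := by ring
  rw [hE, abs_le]
  constructor <;> linarith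

/-! ### Interpolation `min(a, b) ≤ a^{3/4} b^{1/4}` in the form needed -/

/-- If `0 ≤ x ≤ A·R` and `x ≤ B·R³/σ` (`A, B ≥ 0`, `R, σ > 0`) then `x/R² ≤ A^{3/4}B^{1/4}·R^{−1/2}·σ^{−1/4}`. [folklore] -/
theorem interpolate_threeQuarter {x A B R σ : ℝ} (hx : 0 ≤ x) (hA : 0 ≤ A) (hB : 0 ≤ B) (hR : 0 < R) (hσ : 0 < σ)
    (h1 : x ≤ A * R) (h2 : x ≤ B * R ^ 3 / σ) :
    x / R ^ 2 ≤ A ^ (3 / 4 : ℝ) * B ^ (1 / 4 : ℝ) * R ^ (-(1 / 2 : ℝ)) * σ ^ (-(1 / 4 : ℝ)) := by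
  have hsplit : x = x ^ (3 / 4 : ℝ) * x ^ (1 / 4 : ℝ) := by
    rw [← Real.rpow_add' hx (by norm_num : (3 / 4 : ℝ) + 1 / 4 ≠ 0)]
    norm_num
  have hx34 : x ^ (3 / 4 : ℝ) ≤ A ^ (3 / 4 : ℝ) * R ^ (3 / 4 : ℝ) := by
    rw [← Real.mul_rpow hA hR.le]
    exact Real.rpow_le_rpow hx h1 (by norm_num)
  have hx14 : x ^ (1 / 4 : ℝ) ≤ B ^ (1 / 4 : ℝ) * R ^ (3 / 4 : ℝ) * σ ^ (-(1 / 4 : ℝ)) := by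
    have h := Real.rpow_le_rpow hx h2 (by norm_num : (0 : ℝ) ≤ 1 / 4)
    have e : (B * R ^ 3 / σ) ^ (1 / 4 : ℝ) = B ^ (1 / 4 : ℝ) * R ^ (3 / 4 : ℝ) * σ ^ (-(1 / 4 : ℝ)) := by
      rw [Real.div_rpow (by positivity) hσ.le, Real.mul_rpow hB (by positivity), Real.rpow_neg hσ.le,
        show (R ^ 3 : ℝ) = R ^ (3 : ℝ) by exact_mod_cast (Real.rpow_natCast R 3).symm, ← Real.rpow_mul hR.le]
      norm_num
      ring
    rwa [e] at h
  have hR2 : R ^ 2 = R ^ (2 : ℝ) := by exact_mod_cast (Real.rpow_natCast R 2).symm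
  have hprod : x ≤ A ^ (3 / 4 : ℝ) * B ^ (1 / 4 : ℝ) * (R ^ (3 / 4 : ℝ) * R ^ (3 / 4 : ℝ)) * σ ^ (-(1 / 4 : ℝ)) := by
    calc x = x ^ (3 / 4 : ℝ) * x ^ (1 / 4 : ℝ) := hsplit
      _ ≤ (A ^ (3 / 4 : ℝ) * R ^ (3 / 4 : ℝ)) * (B ^ (1 / 4 : ℝ) * R ^ (3 / 4 : ℝ) * σ ^ (-(1 / 4 : ℝ))) :=
          mul_le_mul hx34 hx14 (by positivity) (by positivity)
      _ = A ^ (3 / 4 : ℝ) * B ^ (1 / 4 : ℝ) * (R ^ (3 / 4 : ℝ) * R ^ (3 / 4 : ℝ)) * σ ^ (-(1 / 4 : ℝ)) := by ring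
  have hRR : R ^ (3 / 4 : ℝ) * R ^ (3 / 4 : ℝ) = R ^ (2 : ℝ) * R ^ (-(1 / 2 : ℝ)) := by
    rw [← Real.rpow_add hR, ← Real.rpow_add hR]
    norm_num
  rw [hRR] at hprod
  rw [div_le_iff₀ (by positivity : (0 : ℝ) < R ^ 2), hR2]
  calc x ≤ A ^ (3 / 4 : ℝ) * B ^ (1 / 4 : ℝ) * (R ^ (2 : ℝ) * R ^ (-(1 / 2 : ℝ))) * σ ^ (-(1 / 4 : ℝ)) := hprod
    _ = A ^ (3 / 4 : ℝ) * B ^ (1 / 4 : ℝ) * R ^ (-(1 / 2 : ℝ)) * σ ^ (-(1 / 4 : ℝ)) * R ^ (2 : ℝ) := by ring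

/-! ### B1 -/

variable {C : ℝ} {v : ℝ → EuclideanSpace ℝ (Fin 3) → EuclideanSpace ℝ (Fin 3)}

/-- **The energy in `B̄(c,2R)` on a slice: `≤ 3KR` (S1) and `≤ 8·|B̄(0,1)|·(max C 0)²·R³/(−s)` (rate).** [folklore] -/
theorem energy_closedBall_le (hrate : HasTypeITimeDecay C v) {K : ℝ} (hK0 : 0 ≤ K)
    (hK : ∀ t₀ : ℝ, t₀ < 0 → ∀ (a : EuclideanSpace ℝ (Fin 3)) (ρ : ℝ), 0 < ρ →
      (∫⁻ x in ball a ρ, ENNReal.ofReal (‖v t₀ x‖ ^ 2)) ≤ ENNReal.ofReal (K * ρ))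
    {s : ℝ} (hs : s < 0) (hvc : Continuous (v s)) (c : EuclideanSpace ℝ (Fin 3)) {R : ℝ} (hR : 0 < R) :
    0 ≤ ∫ x in closedBall c (2 * R), ‖v s x‖ ^ 2 ∧
    (∫ x in closedBall c (2 * R), ‖v s x‖ ^ 2 ≤ 3 * K * R) ∧
    (∫ x in closedBall c (2 * R), ‖v s x‖ ^ 2 ≤
      8 * volume.real (ball (0 : EuclideanSpace ℝ (Fin 3)) 1) * max C 0 ^ 2 * R ^ 3 / (-s)) := by
  have hns : 0 < -s := neg_pos.2 hs
  have hint : IntegrableOn (fun x => ‖v s x‖ ^ 2) (closedBall c (2 * R)) :=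
    (hvc.norm.pow 2).continuousOn.integrableOn_compact (isCompact_closedBall _ _)
  refine ⟨setIntegral_nonneg measurableSet_closedBall fun x _ => sq_nonneg _, ?_, ?_⟩
  · have hb := hK s hs c (3 * R) (by positivity)
    have hint3 : IntegrableOn (fun x => ‖v s x‖ ^ 2) (ball c (3 * R)) :=
      ((hvc.norm.pow 2).continuousOn.integrableOn_compact (isCompact_closedBall c (3 * R))).mono_set ball_subset_closedBall
    rw [← ofReal_integral_eq_lintegral_ofReal hint3 (ae_of_all _ fun x => sq_nonneg _)] at hb
    have hK0' : 0 ≤ K * (3 * R) := by positivity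
    have h3 := (ENNReal.ofReal_le_ofReal_iff hK0').1 hb
    calc ∫ x in closedBall c (2 * R), ‖v s x‖ ^ 2 ≤ ∫ x in ball c (3 * R), ‖v s x‖ ^ 2 :=
          setIntegral_mono_set hint3 (ae_of_all _ fun x => sq_nonneg _)
            (ae_of_all _ (closedBall_subset_ball (by linarith) : closedBall c (2 * R) ⊆ ball c (3 * R)))
      _ ≤ K * (3 * R) := h3
      _ = 3 * K * R := by ring
  · have hC0 : 0 ≤ max C 0 := le_max_right _ _
    have hpt : ∀ x ∈ closedBall c (2 * R), ‖v s x‖ ^ 2 ≤ max C 0 ^ 2 / (-s) := by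
      intro x _
      have h := (hrate s hs x).trans (div_le_div_of_nonneg_right (le_max_left C 0) (Real.sqrt_nonneg _))
      have hsq : 0 < Real.sqrt (-s) := Real.sqrt_pos.2 hns
      calc ‖v s x‖ ^ 2 ≤ (max C 0 / Real.sqrt (-s)) ^ 2 := pow_le_pow_left₀ (norm_nonneg _) h 2
        _ = max C 0 ^ 2 / (-s) := by rw [div_pow, Real.sq_sqrt hns.le]
    have hvol : volume.real (closedBall c (2 * R)) = (2 * R) ^ 3 * volume.real (ball (0 : EuclideanSpace ℝ (Fin 3)) 1) := by
      rw [measureReal_def, Measure.addHaar_closedBall volume c (by positivity : (0 : ℝ) ≤ 2 * R), finrank_euclideanSpace_fin,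
        ENNReal.toReal_mul, ENNReal.toReal_ofReal (by positivity), measureReal_def]
    calc ∫ x in closedBall c (2 * R), ‖v s x‖ ^ 2 ≤ ∫ x in closedBall c (2 * R), max C 0 ^ 2 / (-s) :=
          setIntegral_mono_on hint (by exact (continuousOn_const.integrableOn_compact (isCompact_closedBall _ _))) measurableSet_closedBall hpt
      _ = volume.real (closedBall c (2 * R)) * (max C 0 ^ 2 / (-s)) := by rw [setIntegral_const, smul_eq_mul]
      _ = 8 * volume.real (ball (0 : EuclideanSpace ℝ (Fin 3)) 1) * max C 0 ^ 2 * R ^ 3 / (-s) := by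
          rw [hvol]; ring

/-- **STUB B1 (`stub_balanceDatum`) — the BALANCE DATUM**, statement VERBATIM from `Cruxes/PoloidalWindowRigidity/Lines/sonic_cut.lean` (l. 163–178):
the weighted masses of `Q₃`, `det ∇ₕvₕ` and `e = tr((Dv)²)` against any `C²` weight supported in `B̄(c,2R)` with `‖D²χ‖ ≤ R⁻²` are
`≤ K' R^{−1/2}(−s)^{−1/4}`, uniformly in the slice `s < 0`, the centre `c` and the scale `R > 0`. [folklore] -/
theorem stub_balanceDatum :
    ∀ (C : ℝ) (v : ℝ → EuclideanSpace ℝ (Fin 3) → EuclideanSpace ℝ (Fin 3)),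
      Literature.Analysis.FluidPDE.HasTypeITimeDecay C v →
      ContinuousOn (Function.uncurry v) (Set.Iio (0 : ℝ) ×ˢ Set.univ) →
      (∀ s t : ℝ, s < t → t < 0 → ∀ x, v t x =
        Literature.Analysis.UnboundedOperators.heatExtension (v s) (t - s) x -
          Literature.Analysis.FluidPDE.oseenDuhamel 1 s v v t x) →
      (∀ t < 0, Literature.Analysis.FluidPDE.VectorCalculus.IsDivFree (v t)) →
      (∀ s < 0, ∀ y, ⟪Literature.Analysis.FluidPDE.curl (v s) y, EuclideanSpace.single 2 1⟫_ℝ = 0) →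
      (∃ K' : ℝ, 0 ≤ K' ∧ ∀ s : ℝ, s < 0 → ∀ c : EuclideanSpace ℝ (Fin 3), ∀ R : ℝ, 0 < R →
          ∀ χ : EuclideanSpace ℝ (Fin 3) → ℝ, ContDiff ℝ 2 χ → (∀ y, 2 * R ≤ ‖y - c‖ → χ y = 0) →
            (∀ y, ‖iteratedFDeriv ℝ 2 χ y‖ ≤ 1 / R ^ 2) →
            |∫ y, χ y * (fderiv ℝ (v s) y (EuclideanSpace.single 2 1) 0 * fderiv ℝ (v s) y (EuclideanSpace.single 0 1) 2 + fderiv ℝ (v s) y (EuclideanSpace.single 2 1) 1 * fderiv ℝ (v s) y (EuclideanSpace.single 1 1) 2 + fderiv ℝ (v s) y (EuclideanSpace.single 2 1) 2 ^ 2)| ≤ K' * R ^ (-(1 / 2 : ℝ)) * (-s) ^ (-(1 / 4 : ℝ)) ∧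
            |∫ y, χ y * (fderiv ℝ (v s) y (EuclideanSpace.single 0 1) 0 * fderiv ℝ (v s) y (EuclideanSpace.single 1 1) 1 - fderiv ℝ (v s) y (EuclideanSpace.single 1 1) 0 * fderiv ℝ (v s) y (EuclideanSpace.single 0 1) 1)| ≤ K' * R ^ (-(1 / 2 : ℝ)) * (-s) ^ (-(1 / 4 : ℝ)) ∧
            |∫ y, χ y * (∑ i : Fin 3, ∑ j : Fin 3, fderiv ℝ (v s) y (EuclideanSpace.single j 1) i * fderiv ℝ (v s) y (EuclideanSpace.single i 1) j)| ≤ K' * R ^ (-(1 / 2 : ℝ)) * (-s) ^ (-(1 / 4 : ℝ))) := by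
  intro C v hrate hcont hmild hdiv hpol
  obtain ⟨K, hK0, hK⟩ := scaledEnergy hrate hcont hmild hdiv
  set V : ℝ := volume.real (ball (0 : EuclideanSpace ℝ (Fin 3)) 1) with hV
  have hV0 : 0 ≤ V := measureReal_nonneg
  set A : ℝ := 3 * K with hA
  set Bc : ℝ := 8 * V * max C 0 ^ 2 with hBc
  have hA0 : 0 ≤ A := by positivity
  have hB0 : 0 ≤ Bc := by positivity
  set K₀ : ℝ := A ^ (3 / 4 : ℝ) * Bc ^ (1 / 4 : ℝ) with hK₀
  have hK₀0 : 0 ≤ K₀ := by positivity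
  refine ⟨5 / 2 * K₀, by positivity, fun s hs c R hR χ hχ hsupp hD2 => ?_⟩
  have hns : 0 < -s := neg_pos.2 hs
  -- the slice
  have h2s : 2 * s < 0 := by linarith
  have hv2 : ContDiff ℝ 2 (v s) := by
    obtain ⟨p, hcl⟩ := (isTypeIAncientMild_of_class hrate hcont hmild hdiv).exists_isClassicalNSSolutionOn_Ioo h2s
    exact (hcl.contDiff_velocity ⟨by linarith, hs⟩).of_le (by norm_cast)
  have hvc : Continuous (v s) := hv2.continuous
  have htr : ∀ x, fderiv ℝ (v s) x (EuclideanSpace.single 0 1) 0 + fderiv ℝ (v s) x (EuclideanSpace.single 1 1) 1 +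
      fderiv ℝ (v s) x (EuclideanSpace.single 2 1) 2 = 0 := by
    intro x
    have h := hdiv s hs x
    rw [divergence_eq_sum_inner_fderiv (EuclideanSpace.basisFun (Fin 3) ℝ)] at h
    simpa [Fin.sum_univ_three, EuclideanSpace.basisFun_apply, EuclideanSpace.inner_single_left] using h
  have hω : ∀ x, fderiv ℝ (v s) x (EuclideanSpace.single 0 1) 1 = fderiv ℝ (v s) x (EuclideanSpace.single 1 1) 0 := by
    intro x
    have h := hpol s hs x
    rw [EuclideanSpace.inner_single_right, curl_apply_two] at h
    simp only [one_mul, map_sub, RCLike.conj_to_real] at h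
    linarith
  -- the energy in `B̄(c,2R)` and its interpolated bound
  obtain ⟨hE0, hE1, hE2⟩ := energy_closedBall_le hrate hK0 (fun t₀ ht₀ a ρ hρ => (hK t₀ ht₀ a ρ hρ).1) hs hvc c hR
  set E : ℝ := ∫ x in closedBall c (2 * R), ‖v s x‖ ^ 2 with hEdef
  have hE2' : E ≤ Bc * R ^ 3 / (-s) := hE2
  have hI : E / R ^ 2 ≤ K₀ * R ^ (-(1 / 2 : ℝ)) * (-s) ^ (-(1 / 4 : ℝ)) := by
    have h := interpolate_threeQuarter hE0 hA0 hB0 hR hns (by rw [hA]; linarith) hE2'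
    rw [hK₀]; linarith [h]
  -- the three masses, each `≤ (const/R²)·E`
  have he : |∫ y, χ y * (∑ i : Fin 3, ∑ j : Fin 3, fderiv ℝ (v s) y (EuclideanSpace.single j 1) i *
      fderiv ℝ (v s) y (EuclideanSpace.single i 1) j)| ≤ 1 / R ^ 2 * E := by
    have hsum : ∀ y, (∑ i : Fin 3, ∑ j : Fin 3, fderiv ℝ (v s) y (EuclideanSpace.single j 1) i * fderiv ℝ (v s) y (EuclideanSpace.single i 1) j) =
        ∑ i : Fin 3, ⟪(EuclideanSpace.single i (1 : ℝ) : EuclideanSpace ℝ (Fin 3)),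
          fderiv ℝ (v s) y (fderiv ℝ (v s) y (EuclideanSpace.single i (1 : ℝ)))⟫ := by
      intro y
      refine Finset.sum_congr rfl fun i _ => ?_
      have hc : (fderiv ℝ (v s) y (fderiv ℝ (v s) y (EuclideanSpace.single i (1 : ℝ)))) i =
          ∑ j : Fin 3, (fderiv ℝ (v s) y (EuclideanSpace.single i (1 : ℝ))) j * (fderiv ℝ (v s) y (EuclideanSpace.single j (1 : ℝ))) i :=
        clm_apply_coord_eq_sum _ _ _
      have hin : ⟪(EuclideanSpace.single i (1 : ℝ) : EuclideanSpace ℝ (Fin 3)), fderiv ℝ (v s) y (fderiv ℝ (v s) y (EuclideanSpace.single i (1 : ℝ)))⟫ =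
          (fderiv ℝ (v s) y (fderiv ℝ (v s) y (EuclideanSpace.single i (1 : ℝ)))) i := by
        rw [EuclideanSpace.inner_single_left]; simp
      rw [hin, hc]
      exact Finset.sum_congr rfl fun j _ => mul_comm _ _
    simp_rw [hsum]
    exact abs_integral_weight_mul_traceSq_le hv2 (hdiv s hs) hχ hsupp hD2
  have hdet := abs_integral_weight_mul_jacobian_le hv2 hω hχ hsupp hD2
  rw [← hEdef] at hdet
  -- `Q₃ = det + ½ e`
  have hQ : |∫ y, χ y * (fderiv ℝ (v s) y (EuclideanSpace.single 2 1) 0 * fderiv ℝ (v s) y (EuclideanSpace.single 0 1) 2 +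
      fderiv ℝ (v s) y (EuclideanSpace.single 2 1) 1 * fderiv ℝ (v s) y (EuclideanSpace.single 1 1) 2 +
      fderiv ℝ (v s) y (EuclideanSpace.single 2 1) 2 ^ 2)| ≤ 5 / 2 * (1 / R ^ 2 * E) := by
    have hsplit : ∀ y, χ y * (fderiv ℝ (v s) y (EuclideanSpace.single 2 1) 0 * fderiv ℝ (v s) y (EuclideanSpace.single 0 1) 2 +
        fderiv ℝ (v s) y (EuclideanSpace.single 2 1) 1 * fderiv ℝ (v s) y (EuclideanSpace.single 1 1) 2 +
        fderiv ℝ (v s) y (EuclideanSpace.single 2 1) 2 ^ 2) =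
        χ y * (fderiv ℝ (v s) y (EuclideanSpace.single 0 1) 0 * fderiv ℝ (v s) y (EuclideanSpace.single 1 1) 1 -
          fderiv ℝ (v s) y (EuclideanSpace.single 1 1) 0 * fderiv ℝ (v s) y (EuclideanSpace.single 0 1) 1) +
        1 / 2 * (χ y * ∑ i : Fin 3, ⟪(EuclideanSpace.single i (1 : ℝ) : EuclideanSpace ℝ (Fin 3)),
          fderiv ℝ (v s) y (fderiv ℝ (v s) y (EuclideanSpace.single i (1 : ℝ)))⟫) := by
      intro y
      rw [pairing_eq_det_add_half_trace (fderiv ℝ (v s) y) (htr y) (hω y)]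
      ring
    have hχφ : Continuous χ := hχ.continuous
    have hχc : HasCompactSupport χ := by
      refine HasCompactSupport.intro (isCompact_closedBall c (2 * R)) fun y hy => hsupp y ?_
      rw [mem_closedBall, dist_eq_norm, not_le] at hy
      exact hy.le
    have cA : ∀ i j : Fin 3, Continuous fun x => fderiv ℝ (v s) x (EuclideanSpace.single i 1) j := fun i j =>
      (contDiff_euclidean.1 ((hv2.fderiv_right (m := 0) (by norm_num)).clm_apply contDiff_const) j).continuous
    have hDc : Continuous fun x => fderiv ℝ (v s) x := hv2.continuous_fderiv (by norm_num)
    have hIdet : Integrable fun y => χ y * (fderiv ℝ (v s) y (EuclideanSpace.single 0 1) 0 * fderiv ℝ (v s) y (EuclideanSpace.single 1 1) 1 -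
        fderiv ℝ (v s) y (EuclideanSpace.single 1 1) 0 * fderiv ℝ (v s) y (EuclideanSpace.single 0 1) 1) :=
      (hχφ.mul (((cA 0 0).mul (cA 1 1)).sub ((cA 1 0).mul (cA 0 1)))).integrable_of_hasCompactSupport hχc.mul_right
    have hIe : Integrable fun y => 1 / 2 * (χ y * ∑ i : Fin 3, ⟪(EuclideanSpace.single i (1 : ℝ) : EuclideanSpace ℝ (Fin 3)),
        fderiv ℝ (v s) y (fderiv ℝ (v s) y (EuclideanSpace.single i (1 : ℝ)))⟫) :=
      ((hχφ.mul (continuous_finsetSum _ fun i _ => continuous_const.inner (hDc.clm_apply (hDc.clm_apply continuous_const)))).integrable_of_hasCompactSupport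
        hχc.mul_right).const_mul _
    rw [integral_congr_ae (Eventually.of_forall hsplit), integral_add hIdet hIe, MeasureTheory.integral_const_mul]
    have he' := abs_integral_weight_mul_traceSq_le hv2 (hdiv s hs) hχ hsupp hD2
    rw [← hEdef] at he'
    set F : ℝ := 1 / R ^ 2 * E with hF
    have e2 : 2 / R ^ 2 * E = 2 * F := by rw [hF]; ring
    rw [e2] at hdet
    obtain ⟨h1a, h1b⟩ := abs_le.1 hdet
    obtain ⟨h2a, h2b⟩ := abs_le.1 he'
    rw [abs_le]
    constructor <;> linarith
  -- assemble with the interpolated energy bound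
  have hR2E : 1 / R ^ 2 * E = E / R ^ 2 := by ring
  rw [hR2E] at hQ he
  have hdet' : |∫ y, χ y * (fderiv ℝ (v s) y (EuclideanSpace.single 0 1) 0 * fderiv ℝ (v s) y (EuclideanSpace.single 1 1) 1 -
      fderiv ℝ (v s) y (EuclideanSpace.single 1 1) 0 * fderiv ℝ (v s) y (EuclideanSpace.single 0 1) 1)| ≤ 2 * (E / R ^ 2) := by
    have : 2 / R ^ 2 * E = 2 * (E / R ^ 2) := by ring
    rw [← this]; exact hdet
  have hT : 0 ≤ K₀ * R ^ (-(1 / 2 : ℝ)) * (-s) ^ (-(1 / 4 : ℝ)) := by positivity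
  refine ⟨hQ.trans ?_, hdet'.trans ?_, he.trans ?_⟩
  · calc 5 / 2 * (E / R ^ 2) ≤ 5 / 2 * (K₀ * R ^ (-(1 / 2 : ℝ)) * (-s) ^ (-(1 / 4 : ℝ))) := by gcongr
      _ = 5 / 2 * K₀ * R ^ (-(1 / 2 : ℝ)) * (-s) ^ (-(1 / 4 : ℝ)) := by ring
  · calc 2 * (E / R ^ 2) ≤ 2 * (K₀ * R ^ (-(1 / 2 : ℝ)) * (-s) ^ (-(1 / 4 : ℝ))) := by gcongr
      _ ≤ 5 / 2 * K₀ * R ^ (-(1 / 2 : ℝ)) * (-s) ^ (-(1 / 4 : ℝ)) := by nlinarith [hT]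
  · calc E / R ^ 2 ≤ K₀ * R ^ (-(1 / 2 : ℝ)) * (-s) ^ (-(1 / 4 : ℝ)) := hI
      _ ≤ 5 / 2 * K₀ * R ^ (-(1 / 2 : ℝ)) * (-s) ^ (-(1 / 4 : ℝ)) := by nlinarith [hT]

end Summit.NavierStokesRegularity.NavierStokesRegularity.Theorems.PoloidalWindowDoorPoloidalWindowRigidityBalanceDatum

end
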